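import Literature.NumberTheory.EllipticCurves.Tamagawa
import Literature.NumberTheory.EllipticCurves.GaloisAction
import HarnessLib

/-!
# Wuthrich 2014, Lemma 20: at a semistable prime `3`, mod-`3` surjectivity implies `3`-adic surjectivity

Source: C. Wuthrich, *On the integrality of modular symbols and Kato's Euler system for elliptic
curves*, Doc. Math. 19 (2014) 381–402, doi:10.4171/dm/450, §6, Lemma 20 (p. 399), whose proof
uses N. Elkies, *Elliptic curves with 3-adic Galois representation surjective mod 3 but not mod 9*,
arXiv:math/0612734 (2006) — the explicit degree-`27` rational function `f ∈ ℚ(x)` whose values are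
exactly the `j`-invariants of the curves with `ρ̄_{E,3}` surjective and `ρ_{E,3}` not surjective
mod `9`.

Why the tree needs it (cell `bsd-rank1-residual`, class X10, audit `X10-AUDIT.md`): for `ℓ ≥ 5`
"there is no proper closed subgroup of `SL₂(ℤ_ℓ)` that maps surjectively onto `SL₂(ℤ/ℓℤ)`"
(Serre), so `surj(ℓ)` gives `ρ_{E,ℓ}(G_ℚ) = GL₂(ℤ_ℓ)`; at `ℓ = 3` this fails in general (Elkies),
but — Lemma 20 — only for curves with ADDITIVE reduction at `3`. Hence at a good (or
multiplicative) prime `3` the census bit `surj(3)` already yields `3`-adic surjectivity, hence the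
image condition (Im) of Yan–Zhu 2026 / Burungale–Castella–Skinner 2025 (`τ = (1 1; 0 1)`), and the
residual class X10 (`3` good ordinary, `E[3]` irreducible) splits exactly along `surj(3)`.

STATUS OF THE TRANSCRIPTION (2026-08-19, cell literature seat gen 8: the PUBLISHER PDF — EMS Press,
Documenta Mathematica 19 (2014) 381–402, "Received: April 29, 2013, Revised: February 17, 2014,
Communicated by Otmar Venjakob", open access — and the author's version (Nottingham,
`int_kato.pdf`, dated 23 April 2013) were both read; journal pagination below). The statement
display of Lemma 20, which is lost in the hub's older text rendering `paper:doi-10-4171-dm-450`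
(built from the author's version), reads VERBATIM (journal p. 399):

> "Lemma 20. Let `p = 3` and suppose `p²` does not divide the conductor `N`. If the residual
> representation `ρ̄ : Gal(ℚ̄/ℚ) → GL₂(𝔽_p)` is surjective then the `p`-adic representation
> `ρ : Gal(ℚ̄/ℚ) → GL₂(ℤ_p)` is surjective, too."

"`p²` does not divide the conductor" at `p = 3` is exactly "the reduction of `E` at `3` is not
additive", i.e. good or multiplicative — the hypothesis `_hred` below; so the earlier
reconstruction of the statement from the printed proof (this file's first version, flag
`WU14-L20-reconstructed`) coincides with the printed statement word for word in content. Context,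
verbatim (journal pp. 398–399): "Corollary 19. If `E/ℚ` is a semi-stable elliptic curve and `p` an
odd prime where `E` has ordinary reduction, then `char_Λ(X(E))`, or `I char_Λ(X(E))` in the split
multiplicative case, divides the ideal generated by `L_p(E)`. Proof. By a Theorem of Serre ([24,
Proposition 1] and [22, Proposition 21]), we know that the image of the representation
`ρ̄_p : G_ℚ → Aut(E[p])` is either the whole of `GL₂(𝔽_p)` or it is contained in a Borel subgroup.
In the latter case the representation `ρ̄_p` is reducible and in the first case the representation
`ρ_p : G_ℚ → Aut(T_pE)` is surjective by another result of Serre [23, Lemme 15] unless `p = 3`.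
Finally for `p = 3` we use the following lemma to exclude that `ρ_p` is not surjective.
Unfortunately, the hypothesis in Corollary 19 that `E` is semi-stable can not be dropped. For
instance, there are curves `E/ℚ` such that `ρ̄_p` has its image in the normaliser of a non-split
Cartan subgroup." (The words "where `E` has ordinary reduction" in Cor. 19 are in the published
text only; the author's 2013 version and the hub's older rendering lack them.) Proof of Lemma 20
(journal pp. 399–400; prose verbatim, the displayed formulas summarised in brackets because the
PDF text layer does not carry exponents reliably): "We make use of the explicit parametrisation of
all these exotic cases by Elkies in [8]. Let `E/ℚ` be an elliptic curve such that `ρ` is not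
surjective, but `ρ̄` is. Then its `j`-invariant satisfies [display: `j(E) = 1728 −
27·A(n:m)²·B(n:m)²·C(n:m)/D(n:m)⁹` with explicit integral binary forms `A`, `B` (sextic), `C`, `D`
(cubic)] for two coprime integers `n` and `m`. Note first that the denominator `D(n:m)` in `j(E)`
is never divisible by `9`, so `j(E)` is a `3`-adic integer. With a bit more work one can see that
`j(E) ≡ 2·3³ (mod 3⁴)`: [congruences for `A`, `B`, `C`, `D` mod powers of `3` in the two cases
`n ≢ m (mod 3)` and `n = m + 3k`]. Now suppose `E` is given by a Weierstrass equation minimal at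
`3`. We may assume that it is of the form `y² = x³ + a₂x² + a₄x + a₆` with `a₂ ∈ {−1, 0, +1}` and
`a₄, a₆ ∈ ℤ`. If `a₂ = ±1`, then [display: `j(E)` as a cubic in `a₄` over `Δ`] where `Δ` is the
discriminant. However this is a contradiction with `j(E) ∈ 3³ℤ₃`. Hence `a₂ = 0` and so [display:
`j(E) = 3³·2⁶·a₄³/(a₄³ + 27a₆²/4)`] and we see that it is impossible that `j(E) ≡ 2·3³ (mod 3⁴)`
unless `3` divides `a₄` and the discriminant `Δ = 4a₄³ + 27a₆²`. Therefore `E` has bad reduction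
at `3`. The fact that `j(E)` is a `3`-adic integer shows that the reduction is additive." The same
reading was recorded independently by the census's literature seat (`RESIDUAL-CASES.md` (a-S2)
S11(i)). The fact below is the contrapositive, stated with the tree's predicates; "`ρ_{E,3}`
surjective" is spelled "every `ρ̄_{E,3^n}` is surjective" exactly as in bsd.S20 `kato_divisibility`
(3). JOURNAL PAGINATION of the statements of this paper cited in the tree (publisher PDF): Thm. 1,
Thm. 2 p. 382; Thm. 3 p. 383; Thm. 4, Lemma 5 p. 384; Cor. 7 p. 387; §3 from p. 388; Thm. 13
p. 395; Lemma 14 p. 396; Prop. 15, Thm. 16, Lemma 17 and §5 p. 397; §6, Cor. 18, Cor. 19 p. 398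
(proof of Cor. 19 p. 399); Lemma 20 p. 399; Prop. 21 p. 400 (older tree locators "Thm. 16
(p. 393)", "Cor. 18/19 (p. 394)", "Lemma 20 (p. 400)" count pages of the author's version).

## References

* C. Wuthrich, Doc. Math. 19 (2014) 381–402, doi:10.4171/dm/450: Lemma 20 (p. 399), Cor. 19
  (pp. 398–399). [Wuthrich2014]
* N. D. Elkies, arXiv:math/0612734 (2006), Abstract and §4 (all listed curves have `3⁵ ∣ N`).
* J.-P. Serre, *Abelian ℓ-adic representations and elliptic curves* (1968), IV-23, Lemma 3 and
  exercises (the `ℓ ≥ 5` statement and the `ℓ = 3` exception).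
-/

noncomputable section

open scoped Classical

open WeierstrassCurve

namespace Literature.NumberTheory.EllipticCurves.Wuthrich2014

/-- **Wuthrich, Doc. Math. 19 (2014), Lemma 20 (p. 399)**, verbatim: "Let `p = 3` and suppose `p²`
does not divide the conductor `N`. If the residual representation `ρ̄ : Gal(ℚ̄/ℚ) → GL₂(𝔽_p)` is
surjective then the `p`-adic representation `ρ : Gal(ℚ̄/ℚ) → GL₂(ℤ_p)` is surjective, too."
Transcription: "`3² ∤ N`" = the reduction of `E/ℚ` at `3` is not additive, i.e. good or
multiplicative (`_hred`); "`ρ̄` surjective" = `HasSurjectiveModNGaloisRep 3`; "`ρ` surjective onto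
`GL₂(ℤ₃)`" = `ρ̄_{E,3^n}` surjective for every `n` (the spelling of bsd.S20 `kato_divisibility`
(3)). Printed proof (pp. 399–400): a curve with `ρ̄` surjective and `ρ` not surjective has, by
Elkies' parametrisation (arXiv:math/0612734), `j(E) ∈ 3³ℤ₃` and "Therefore `E` has bad reduction
at `3`. The fact that `j(E)` is a `3`-adic integer shows that the reduction is additive." Used in
the paper for Cor. 19 at `p = 3` ("for `p = 3` we use the following lemma to exclude that `ρ_p` is
not surjective", p. 399). [cite: Wuthrich2014, Lemma 20 (p. 399)] -/
def lemma20_surjective_threeAdic_of_semistable : Prop :=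
  ∀ (W : WeierstrassCurve ℚ) [W.IsElliptic]
    (_hred : W.HasGoodReductionAtPrime 3 ∨ W.HasMultiplicativeReductionAtPrime 3)
    (_hsurj : W.HasSurjectiveModNGaloisRep 3),
    ∀ n : ℕ, W.HasSurjectiveModNGaloisRep (3 ^ n : ℕ)

end Literature.NumberTheory.EllipticCurves.Wuthrich2014

end
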